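import Mathlib

/-!
# Stub `stub_alignedNilpotentCorner` of line `crossing-split-integrability`
(crux `Summit.QuantumFields.QCD.Theses.PauliWegnerSea.PhaseQuenchedFlavourDecay`, item stmt-QuantumFields-9151)

**The aligned nilpotent corner (Mathlib only).**  For an invertible complex square matrix `A` and
vectors `a`, `b` with the ALIGNMENT condition `bᴴ A⁻¹ a = 0`, along the whole one-parameter family
`A - t • a bᴴ` the determinant is `t`-blind while the inverse moves linearly in `t`:

* `det (A - t • a bᴴ) = det A` — matrix determinant lemma
  `det (A - t • a bᴴ) = det A · (1 - t · bᴴ A⁻¹ a)` (`Matrix.det_add_replicateCol_mul_replicateRow`)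
  with the bracket equal to `1`;
* `(A - t • a bᴴ)⁻¹ = A⁻¹ + t • (A⁻¹ a) (bᴴ A⁻¹)` — Sherman–Morrison with unit denominator: the
  candidate is a right inverse because the `t²` cross term is `(bᴴ A⁻¹ a) • a (bᴴ A⁻¹) = 0`
  (`Matrix.vecMulVec_mul_vecMulVec`) and the two `t`-linear terms cancel
  (`Matrix.mul_vecMulVec`, `Matrix.vecMulVec_mul`); conclude with `Matrix.inv_eq_right_inv`.
-/

noncomputable section

namespace Summit.QuantumFields.QCD.Cruxes.PhaseQuenchedFlavourDecay.CrossingSplitIntegrability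

open Matrix

/-- **Matrix determinant lemma for a scaled rank-one downdate**: for invertible `A`,
`det (A - t • u vᵀ) = det A · (1 - t · (v ⬝ᵥ A⁻¹ u))`. -/
theorem alignedNilpotentCorner_det_sub_smul_vecMulVec {m : Type*} [Fintype m] [DecidableEq m]
    {A : Matrix m m ℂ} (hA : IsUnit A.det) (u v : m → ℂ) (t : ℂ) :
    (A - t • vecMulVec u v).det = A.det * (1 - t * (v ⬝ᵥ A⁻¹ *ᵥ u)) := by
  have h := det_add_replicateCol_mul_replicateRow (ι := Unit) hA (-(t • u)) v
  rw [← vecMulVec_eq, neg_vecMulVec, smul_vecMulVec, ← sub_eq_add_neg] at h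
  rw [h]
  congr 1
  rw [det_unique, Matrix.add_apply, Matrix.one_apply_eq, ← Matrix.replicateRow_vecMul,
    Matrix.replicateRow_mul_replicateCol_apply, ← dotProduct_mulVec, mulVec_neg, mulVec_smul,
    dotProduct_neg, dotProduct_smul, smul_eq_mul, sub_eq_add_neg]

/-- **Sherman–Morrison with unit denominator**: if `v ⬝ᵥ A⁻¹ u = 0` then
`A⁻¹ + t • (A⁻¹ u) (vᵀ A⁻¹)` is a right inverse of `A - t • u vᵀ`. -/
theorem alignedNilpotentCorner_mul_eq_one {m : Type*} [Fintype m] [DecidableEq m]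
    {A : Matrix m m ℂ} (hA : IsUnit A.det) {u v : m → ℂ} (huv : v ⬝ᵥ A⁻¹ *ᵥ u = 0) (t : ℂ) :
    (A - t • vecMulVec u v) * (A⁻¹ + t • vecMulVec (A⁻¹ *ᵥ u) (v ᵥ* A⁻¹)) = 1 := by
  have h1 : A *ᵥ (A⁻¹ *ᵥ u) = u := by rw [mulVec_mulVec, mul_nonsing_inv A hA, one_mulVec]
  rw [sub_mul, mul_add, mul_add, mul_nonsing_inv A hA, Matrix.mul_smul, mul_vecMulVec, h1,
    Matrix.smul_mul, Matrix.smul_mul, Matrix.mul_smul, vecMulVec_mul, vecMulVec_mul_vecMulVec,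
    huv, zero_smul, vecMulVec_zero, smul_zero, smul_zero, add_zero, add_sub_cancel_right]

/-- **Inverse of the aligned downdate**: if `A` is invertible and `v ⬝ᵥ A⁻¹ u = 0` then
`(A - t • u vᵀ)⁻¹ = A⁻¹ + t • (A⁻¹ u) (vᵀ A⁻¹)`. -/
theorem alignedNilpotentCorner_inv_sub_smul_vecMulVec {m : Type*} [Fintype m] [DecidableEq m]
    {A : Matrix m m ℂ} (hA : IsUnit A.det) {u v : m → ℂ} (huv : v ⬝ᵥ A⁻¹ *ᵥ u = 0) (t : ℂ) :
    (A - t • vecMulVec u v)⁻¹ = A⁻¹ + t • vecMulVec (A⁻¹ *ᵥ u) (v ᵥ* A⁻¹) :=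
  inv_eq_right_inv (alignedNilpotentCorner_mul_eq_one hA huv t)

/-! ### The registered stub -/

/-- **Registered stub `stub_alignedNilpotentCorner`** (additive, Mathlib-only; lead c1's obstruction
to every FIBREWISE domination, in abstract form).  If the outside resolvent couples into the star
through an ALIGNED rank-one structure — `bᴴ A⁻¹ a = 0` — then along the whole one-parameter family
`A − t·a bᴴ` the determinant is `t`-blind while the inverse moves linearly in `t`:
`det(A − t·a bᴴ) = det A` and `(A − t·a bᴴ)⁻¹ = A⁻¹ + t·(A⁻¹ a)(bᴴ A⁻¹)` (matrix determinant lemma +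
Sherman–Morrison with unit denominator). -/
theorem stub_alignedNilpotentCorner :
    ∀ (n : ℕ) (A : Matrix (Fin n) (Fin n) ℂ) (a b : Fin n → ℂ), IsUnit A.det → dotProduct (star b) (A⁻¹.mulVec a) = 0 →
      ∀ t : ℂ, (A - t • Matrix.vecMulVec a (star b)).det = A.det ∧
        (A - t • Matrix.vecMulVec a (star b))⁻¹ = A⁻¹ + t • Matrix.vecMulVec (A⁻¹.mulVec a) (Matrix.vecMul (star b) A⁻¹) := by
  intro n A a b hA hal t
  refine ⟨?_, alignedNilpotentCorner_inv_sub_smul_vecMulVec hA hal t⟩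
  rw [alignedNilpotentCorner_det_sub_smul_vecMulVec hA, hal, mul_zero, sub_zero, mul_one]

end Summit.QuantumFields.QCD.Cruxes.PhaseQuenchedFlavourDecay.CrossingSplitIntegrability

end
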